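import Mathlib
import Summits.NavierStokesRegularity.NavierStokesRegularity.Theorems.EulerZoomLiouvillePowerGaugeEulerLiouvilleEnergyVanishing
import HarnessLib

/-!
# The endpoint `ρ = 1/2` of the crux `EulerZoomLiouville.PowerGaugeEulerLiouville`: the energy dichotomy
# (stmt-NavierStokesRegularity-19832, lead's line `birth`)

At the energy-conserving exponent `ρ = 1/2` (`α = 3/2`) every member of Seregin's power-gauged ancient Euler
class is finite-energy (`lintegral_enorm_sq_le_of_gauge_half`, `…EnergyVanishingTools.lean`), and the stratum
«no Euler collapse from an energy-quiescent past» (`powerGaugeEulerLiouville_of_energyVanishing`,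
`…EnergyVanishing.lean`, `2/5 < ρ`) applies.  Together:

* `powerGaugeEulerLiouville_half_dichotomy` — **an endpoint member is trivial, OR its (finite, `≤ c`) total
  energy stays above some `ε > 0` at a.e. time of some far past `(−∞,−N)`.**  A nontrivial endpoint member
  carries its energy from `t = −∞`: it cannot import energy from spatial infinity at finite total energy, and
  cannot create it (local energy inequality).  The exactly self-similar endpoint candidates
  `u = (−τ)^{-3/5} V((−τ)^{-2/5} y)` (`‖u(τ)‖₂ = ‖V‖₂` constant) sit in the second alternative; their
  non-existence (Chae–Shvydkoy 2013 Thm 3.1 needs pointwise power bounds; Chae–Wolf 2019 for DSS atoms) is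
  the open endpoint of the window.

WHAT THIS IS NOT: not NS regularity, not the open core `stub_noCollapseFromZero`; an in-window endpoint
stratum `--supports` stmt-19832. [folklore]
-/


noncomputable section

set_option linter.dupNamespace false

open MeasureTheory Set Filter Topology Metric Function TopologicalSpace
open scoped ENNReal NNReal InnerProductSpace RealInnerProductSpace Laplacian

namespace Summit.NavierStokesRegularity.NavierStokesRegularity.Theorems.PowerGaugeEulerLiouville

open Literature.Analysis Literature.Analysis.FunctionSpaces Literature.Analysis.FluidPDE

/-- **Endpoint dichotomy (`ρ = 1/2`): a member of the power-gauged class at the energy-conserving exponent is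
trivial, OR its (finite, `≤ c`) total energy stays above some `ε > 0` at a.e. time of some far past
`(−∞, −N)`.**  Contrapositive of `powerGaugeEulerLiouville_of_energyVanishing` at `ρ = 1/2 > 2/5`, where
`lintegral_enorm_sq_le_of_gauge_half` makes the energy finite: a NONTRIVIAL endpoint member carries its
energy from `t = −∞` (energy cannot enter from spatial infinity at finite total energy and cannot be
created, by the local energy inequality).  The exactly self-similar endpoint candidates
`u = (−τ)^{-3/5} V((−τ)^{-2/5} y)` have `‖u(τ)‖₂ = ‖V‖₂` constant — the second alternative. [folklore] -/
theorem powerGaugeEulerLiouville_half_dichotomy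
    (u : ℝ → EuclideanSpace ℝ (Fin 3) → EuclideanSpace ℝ (Fin 3)) (p : ℝ → EuclideanSpace ℝ (Fin 3) → ℝ)
    (H : ℝ → EuclideanSpace ℝ (Fin 3) → EuclideanSpace ℝ (Fin 3) →L[ℝ] EuclideanSpace ℝ (Fin 3)) (c : ℝ≥0)
    (hsw : IsSuitableWeakSolutionOn (slab (EuclideanSpace ℝ (Fin 3)) (Set.Iio 0) isOpen_Iio) 0 0 u p)
    (hH : HasWeakSpatialGradientOn (slab (EuclideanSpace ℝ (Fin 3)) (Set.Iio 0) isOpen_Iio) u H)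
    (hc : ∀ a : ℝ, 0 < a → ENNReal.ofReal (a ^ (2 * (1 / 2 : ℝ))) * cknA a (0 : ℝ × EuclideanSpace ℝ (Fin 3)) u +
        ENNReal.ofReal (a ^ (1 / 2 : ℝ)) * cknE a (0 : ℝ × EuclideanSpace ℝ (Fin 3)) H +
        ENNReal.ofReal (a ^ (2 * (1 / 2 : ℝ))) * cknD a (0 : ℝ × EuclideanSpace ℝ (Fin 3)) p ≤ (c : ℝ≥0∞)) :
    Function.uncurry u =ᵐ[volume.restrict (Set.Iio (0 : ℝ) ×ˢ (Set.univ : Set (EuclideanSpace ℝ (Fin 3))))] 0 ∨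
      ((∀ τ : ℝ, τ < 0 → ∫⁻ x, ‖u τ x‖ₑ ^ 2 ≤ (c : ℝ≥0∞)) ∧
        ∃ ε : ℝ, 0 < ε ∧ ∃ N : ℝ, ∀ᵐ s ∂(volume : Measure ℝ), s < -N →
          ENNReal.ofReal ε < ∫⁻ x, ‖u s x‖ₑ ^ 2) := by
  have hA : ∀ a : ℝ, 0 < a →
      ENNReal.ofReal (a ^ (2 * (1 / 2 : ℝ))) * cknA a (0 : ℝ × EuclideanSpace ℝ (Fin 3)) u ≤ (c : ℝ≥0∞) :=
    fun a ha => le_trans (le_trans le_self_add le_self_add) (hc a ha)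
  have hfin : ∀ τ : ℝ, τ < 0 → ∫⁻ x, ‖u τ x‖ₑ ^ 2 ≤ (c : ℝ≥0∞) :=
    fun τ hτ => lintegral_enorm_sq_le_of_gauge_half hA hτ
  by_cases hvan : ∀ ε : ℝ, 0 < ε → ∀ N : ℝ,
      volume {s : ℝ | s < -N ∧ ∫⁻ x, ‖u s x‖ₑ ^ 2 ≤ ENNReal.ofReal ε} ≠ 0
  · exact Or.inl (powerGaugeEulerLiouville_of_energyVanishing (1 / 2) (by norm_num) u p H c hsw hH hc hvan)
  · right
    refine ⟨hfin, ?_⟩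
    push Not at hvan
    obtain ⟨ε, hε, N, hN⟩ := hvan
    refine ⟨ε, hε, N, ?_⟩
    have h : ∀ᵐ s ∂(volume : Measure ℝ), ¬ (s < -N ∧ ∫⁻ x, ‖u s x‖ₑ ^ 2 ≤ ENNReal.ofReal ε) := by
      rw [ae_iff]
      simpa only [not_not] using hN
    filter_upwards [h] with s hs hsN
    exact not_le.1 fun hle => hs ⟨hsN, hle⟩

end Summit.NavierStokesRegularity.NavierStokesRegularity.Theorems.PowerGaugeEulerLiouville

end
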